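/-
Copyright (c) 2026 the pub-hodgecm-mathlib formalisation cell (harness21).  Prover seat hodgecm-mathlib-K2E3-p17 (g11), HCML Track B «K2-LIT» ∕ h413
(`stmt-HodgeConjecture-24833`), R90-TF section S3, (U3-F) brick P7 «`F′(√γ)` is a CM field for `F′` totally real and `γ` totally negative» (dealt BY
NAME «captain's choice» by the S3 dealer R90-C12-plan (g2) 2026-09-05T00:23:15Z, memo `R90/R90-C12-plan/g2/DEAL-S3-U3F-SPLIT.v1.md` §1 row P7 = census
F-b1 of K2E3-p17 (g10)).  2026-09-05.
-/
import Mathlib.NumberTheory.NumberField.CMField            -- `NumberField.IsCMField`, `IsCMField.ofCMExtension`, `CMExtension.equivMaximalRealSubfield`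
import Mathlib.FieldTheory.KummerPolynomial                -- `X_pow_sub_C_irreducible_of_prime`
import Mathlib.RingTheory.AdjoinRoot                       -- `AdjoinRoot`, `AdjoinRoot.powerBasis`
import HarnessLib

/-!
# R90-TF · S3 · THEOREMS — `R90S3CMOfTotNegRadicand` ((U3-F) brick P7): a square root of a TOTALLY NEGATIVE element of a totally real
# number field generates a totally complex field; a quadratic such extension is a CM FIELD (as a TYPE, with `F ≃ K⁺` and the degree of `K⁺`)

R90-TF section S3 (dealer R90-C12-plan (g2), planner split `DEAL-S3-U3F-SPLIT.v1.md` §1 row P7); crux H413 (`stmt-HodgeConjecture-24833`, lane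
`--supports … --as helper`), route `HCCMUnconditional`.  Serves step F-b of the ℚ-PLANTED road behind the socket `stub_R90_S3_auxGlobaliseField`
(`Cruxes/H413/Lines/R90_S3_LocalTransportWaveG.lean` :645): with `F′ = ℚ(α)` totally real (T3 ★ `R90S3RealRootedOfSignAlternation`, P3, P4 ★
`R90S3IrreducibleOfIrreducibleMod`) and `α` TOTALLY NEGATIVE, the field `L′ := F′(√α)` must be produced as a TYPE `L′ : Type` carrying `Field`, `NumberField`,
`IsCMField` (Mathlib `NumberField.IsCMField` — the socket's currency) with `F′ ≃+* L′⁺ := maximalRealSubfield L′` and `[L′⁺ : ℚ] = [F′ : ℚ]` (the socket's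
`3 ≤ [L′⁺ : ℚ]`).  MATHLIB ROAD: `IsCMField.ofCMExtension F K` (CM from a totally real `F`, a totally complex `K`, `[K : F] = 2`) and
`CMExtension.equivMaximalRealSubfield F K : F ≃+* K⁺`; this file supplies the missing input «`K` is totally complex» from the sign of the radicand, the
irreducibility of `X² − γ`, the construction of `K` (inside a proof: `AdjoinRoot (X ^ 2 − C γ)` — no `def` in a Theorems file), and the degree bookkeeping.
PURE MATHLIB; THEOREMS ONLY (no `def`, no `instance`, no notation, no named fact, no `sorry`); never imports `Cruxes/…/Lines`.

THE MATHEMATICS [folklore; Shimura–Taniyama, *Complex multiplication of abelian varieties* §5 / Milne CM notes §1: «a CM field is a totally imaginary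
quadratic extension of a totally real field», e.g. `F(√γ)` with `γ ∈ F` totally negative].  «Totally negative» is stated on complex embeddings:
`∀ σ : F →+* ℂ, re (σ γ) < 0` (for totally real `F` every `σ γ` is real, so this says every conjugate of `γ` is a negative real; it is what T3∕P3 deliver:
all roots of `minpoly α` are negative reals).  (a) If `θ² = γ` in a field `K ⊇ F` and `φ : K →+* ℂ` were REAL (`conj ∘ φ = φ`), then `z := φ θ` is real and
`re (φ|_F γ) = re (z²) = (re z)² ≥ 0`, contradicting negativity; so EVERY complex embedding of EVERY field containing `F(θ)` is non-real — `K` is totally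
complex (no degree hypothesis).  (b) With `[K : F] = 2` and `F` totally real, Mathlib's `IsCMField.ofCMExtension` gives `IsCMField K`, and `F ≃+* K⁺`.
(c) `γ` is not a square in `F` (a square `b²` has `re (σ b²) = (re σ b)² ≥ 0` at a real `σ`, and a number field has an embedding), so `X² − γ` is irreducible
(Mathlib `X_pow_sub_C_irreducible_of_prime`) and `K := F[X]∕(X² − γ)` is a field, finite of degree `2` over `F` (power basis), hence a number field.
(d) `[K⁺ : ℚ] = [F : ℚ]` from `[K : ℚ] = 2 [F : ℚ] = 2 [K⁺ : ℚ]`.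
* §1 (any fields `F ⊆ K`) **`not_isReal_of_sq_eq_of_forall_re_neg`**, `isComplex_mk_of_sq_eq_of_forall_re_neg`, **`isTotallyComplex_of_sq_eq_of_forall_re_neg`**.
* §2 **`isCMField_of_sq_eq_of_forall_re_neg`** (`[NumberField K] [IsTotallyReal F] [IsQuadraticExtension F K]`), `finrank_rat_eq_two_mul_of_isQuadraticExtension`,
  **`finrank_maximalRealSubfield_eq_of_isQuadraticExtension`** (`[K⁺ : ℚ] = [F : ℚ]`), `le_finrank_maximalRealSubfield_of_isQuadraticExtension` (the socket's `3 ≤`).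
* §3 `forall_sq_ne_of_forall_re_neg` (not a square), **`irreducible_X_sq_sub_C_of_forall_re_neg`**, `natDegree_X_sq_sub_C`.
* §4 THE TYPE: **`exists_isCMField_of_forall_re_neg`** — `∃ (K : Type) (_ : Field K) (_ : NumberField K) (_ : Algebra F K), IsQuadraticExtension F K ∧
  IsCMField K ∧ (∃ θ : K, θ ^ 2 = algebraMap F K γ) ∧ Module.finrank ℚ ↥(maximalRealSubfield K) = Module.finrank ℚ F` (for `F : Type`, as the socket's `L′ : Type`).
* §5 TRANSPORT along `F ≃+* K⁺` (Mathlib `CMExtension.equivMaximalRealSubfield`; lemmas for any ring isomorphism `e` of characteristic-zero fields):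
  `norm_rat_ringEquiv_apply`, `minpoly_rat_ringEquiv_apply`, `isIntegral_int_ringEquiv_apply_iff`, `forall_re_neg_ringEquiv_apply_iff`, and
  `sq_eq_algebraMap_equivMaximalRealSubfield` (the square root read over `K⁺`).

HONEST LABEL: HC_CM is proved only modulo the 7 printed citations (2 remaining named inputs: hLiu418 = stmt-HodgeConjecture-24832, h413 =
stmt-HodgeConjecture-24833) until rung 0 closes; elementary field theory for a sub-step of a GENUINE residual ((U3-F)); proves nothing printed; count-neutral.

## References
* [ShimuraTaniyama1961] G. Shimura, Y. Taniyama, *Complex multiplication of abelian varieties and its applications to number theory* (1961), §5.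
* [Rogawski1990] J. D. Rogawski, *Automorphic Representations of Unitary Groups in Three Variables*, Ann. of Math. Stud. 123 (1990), §13.8 p. 216 («we can
  choose `E∕F` … such that … `E∕F` is a CM field»).
-/

set_option autoImplicit false
-- the mandated namespace repeats the single-problem summit's segment (`HodgeConjecture.HodgeConjecture`)
set_option linter.dupNamespace false

noncomputable section

namespace Summit.HodgeConjecture.HodgeConjecture.R90.S3

open NumberField NumberField.InfinitePlace Polynomial Algebra

/-! ## §1 A square root of a totally negative element kills every real embedding -/

section AnyField

variable {F : Type*} [Field F] {K : Type*} [Field K] [Algebra F K]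

/-- **No real embedding above a totally negative radicand.**  If `θ² = γ` in `K ⊇ F` and every conjugate of `γ` has negative real part, then no complex
embedding of `K` is real: for a real `φ`, `z := φ θ` is real and `re (φ γ) = re (z²) = (re z)² ≥ 0`. [folklore] -/
theorem not_isReal_of_sq_eq_of_forall_re_neg {γ : F} (hγ : ∀ σ : F →+* ℂ, (σ γ).re < 0) {θ : K} (hθ : θ ^ 2 = algebraMap F K γ)
    (φ : K →+* ℂ) : ¬ ComplexEmbedding.IsReal φ := by
  intro hφ
  -- `z := φ θ` is real
  have him : (φ θ).im = 0 := by
    have h := RingHom.congr_fun (ComplexEmbedding.isReal_iff.mp hφ) θ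
    rw [ComplexEmbedding.conjugate_coe_eq] at h
    exact Complex.conj_eq_iff_im.mp h
  -- `re ((φ ∘ algebraMap) γ) = re ((φ θ)²) = (re (φ θ))² ≥ 0`
  have hneg := hγ (φ.comp (algebraMap F K))
  have hsq : (φ.comp (algebraMap F K)) γ = (φ θ) ^ 2 := by
    rw [RingHom.comp_apply, ← hθ, map_pow]
  rw [hsq, sq, Complex.mul_re, him, mul_zero, sub_zero] at hneg
  exact (not_lt.mpr (mul_self_nonneg (φ θ).re)) hneg

/-- The infinite place of any complex embedding of `K` is complex (same hypotheses). [folklore] -/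
theorem isComplex_mk_of_sq_eq_of_forall_re_neg {γ : F} (hγ : ∀ σ : F →+* ℂ, (σ γ).re < 0) {θ : K} (hθ : θ ^ 2 = algebraMap F K γ)
    (φ : K →+* ℂ) : (InfinitePlace.mk φ).IsComplex :=
  isComplex_mk_iff.mpr (not_isReal_of_sq_eq_of_forall_re_neg hγ hθ φ)

/-- **`K` is totally complex** as soon as it contains `F(θ)` with `θ² = γ` totally negative (no degree hypothesis). [folklore] -/
theorem isTotallyComplex_of_sq_eq_of_forall_re_neg {γ : F} (hγ : ∀ σ : F →+* ℂ, (σ γ).re < 0) {θ : K} (hθ : θ ^ 2 = algebraMap F K γ) :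
    IsTotallyComplex K := by
  refine ⟨fun v => ?_⟩
  have h := isComplex_mk_of_sq_eq_of_forall_re_neg hγ hθ v.embedding
  rwa [mk_embedding] at h

end AnyField

/-! ## §2 Quadratic over totally real ⇒ CM (Mathlib `IsCMField.ofCMExtension`), and the degree of the maximal real subfield -/

section Quadratic

variable (F : Type*) [Field F] (K : Type*) [Field K] [NumberField K] [Algebra F K]

/-- **CM field from a totally negative radicand.**  `F` totally real, `[K : F] = 2`, `θ² = γ` with `γ` totally negative ⇒ `IsCMField K` (Mathlib
`IsCMField.ofCMExtension` on top of §1). [folklore] -/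
theorem isCMField_of_sq_eq_of_forall_re_neg [IsTotallyReal F] [IsQuadraticExtension F K] {γ : F} (hγ : ∀ σ : F →+* ℂ, (σ γ).re < 0) {θ : K}
    (hθ : θ ^ 2 = algebraMap F K γ) : IsCMField K := by
  haveI : IsTotallyComplex K := isTotallyComplex_of_sq_eq_of_forall_re_neg hγ hθ
  haveI : Algebra.IsIntegral ℚ K := Algebra.IsIntegral.of_finite ℚ K
  exact IsCMField.ofCMExtension F K

omit [NumberField K] in
/-- `[K : ℚ] = 2 · [F : ℚ]` for a quadratic extension `K ∕ F` (Mathlib's `finrank` conventions make this unconditional). [folklore] -/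
theorem finrank_rat_eq_two_mul_of_isQuadraticExtension [CharZero F] [Algebra ℚ K] [Algebra ℚ F] [IsScalarTower ℚ F K] [IsQuadraticExtension F K] :
    Module.finrank ℚ K = 2 * Module.finrank ℚ F := by
  rw [← Module.finrank_mul_finrank ℚ F K, IsQuadraticExtension.finrank_eq_two F K, mul_comm]

/-- **`[K⁺ : ℚ] = [F : ℚ]`** for a CM field `K` quadratic over `F` (both equal `[K : ℚ] ∕ 2`). [folklore] -/
theorem finrank_maximalRealSubfield_eq_of_isQuadraticExtension [IsCMField K] [Algebra ℚ F] [CharZero F] [IsScalarTower ℚ F K]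
    [IsQuadraticExtension F K] : Module.finrank ℚ ↥(maximalRealSubfield K) = Module.finrank ℚ F := by
  have h1 : Module.finrank ℚ ↥(maximalRealSubfield K) * 2 = Module.finrank ℚ K := by
    rw [← IsQuadraticExtension.finrank_eq_two ↥(maximalRealSubfield K) K]
    exact Module.finrank_mul_finrank ℚ ↥(maximalRealSubfield K) K
  have h2 : Module.finrank ℚ F * 2 = Module.finrank ℚ K := by
    rw [← IsQuadraticExtension.finrank_eq_two F K]
    exact Module.finrank_mul_finrank ℚ F K
  omega

/-- The socket's degree clause: `d ≤ [F : ℚ] ⇒ d ≤ [K⁺ : ℚ]` (used with `d = 3`). [folklore] -/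
theorem le_finrank_maximalRealSubfield_of_isQuadraticExtension [IsCMField K] [Algebra ℚ F] [CharZero F] [IsScalarTower ℚ F K]
    [IsQuadraticExtension F K] {d : ℕ} (hd : d ≤ Module.finrank ℚ F) : d ≤ Module.finrank ℚ ↥(maximalRealSubfield K) := by
  rwa [finrank_maximalRealSubfield_eq_of_isQuadraticExtension F K]

end Quadratic

/-! ## §3 The radicand is not a square; `X² − γ` is irreducible -/

section Radicand

variable {F : Type*} [Field F] [NumberField F] [IsTotallyReal F]

/-- A totally negative element of a totally real number field is not a square (read at one real embedding: `re (σ b²) = (re σ b)² ≥ 0`). [folklore] -/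
theorem forall_sq_ne_of_forall_re_neg {γ : F} (hγ : ∀ σ : F →+* ℂ, (σ γ).re < 0) : ∀ b : F, b ^ 2 ≠ γ := by
  intro b hb
  obtain ⟨σ⟩ : Nonempty (F →+* ℂ) := inferInstance
  have hreal : ComplexEmbedding.IsReal σ := IsTotallyReal.complexEmbedding_isReal σ
  have him : (σ b).im = 0 := by
    have h := RingHom.congr_fun (ComplexEmbedding.isReal_iff.mp hreal) b
    rw [ComplexEmbedding.conjugate_coe_eq] at h
    exact Complex.conj_eq_iff_im.mp h
  have hneg := hγ σ
  rw [← hb, map_pow, sq, Complex.mul_re, him, mul_zero, sub_zero] at hneg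
  exact (not_lt.mpr (mul_self_nonneg (σ b).re)) hneg

/-- **`X² − γ` is irreducible over `F`** for `γ` totally negative (Mathlib `X_pow_sub_C_irreducible_of_prime` at `p = 2`). [folklore] -/
theorem irreducible_X_sq_sub_C_of_forall_re_neg {γ : F} (hγ : ∀ σ : F →+* ℂ, (σ γ).re < 0) : Irreducible (X ^ 2 - C γ : F[X]) :=
  X_pow_sub_C_irreducible_of_prime Nat.prime_two (forall_sq_ne_of_forall_re_neg hγ)

omit [NumberField F] [IsTotallyReal F] in
/-- `natDegree (X² − C γ) = 2`. [folklore] -/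
theorem natDegree_X_sq_sub_C (γ : F) : (X ^ 2 - C γ : F[X]).natDegree = 2 := natDegree_X_pow_sub_C

end Radicand

/-! ## §4 The CM field `F(√γ)` as a TYPE -/

/-- **The CM field `F(√γ)`.**  For a totally real number field `F : Type` and a totally negative `γ ∈ F` there is a TYPE `K` with `Field`, `NumberField`,
`Algebra F K` instances such that `K ∕ F` is quadratic, `K` is a CM field (Mathlib `NumberField.IsCMField`, the (U3-F) socket's currency), `γ` has a square
root `θ` in `K`, and `[K⁺ : ℚ] = [F : ℚ]`; namely `K := F[X]∕(X² − γ)` (`AdjoinRoot`, built inside the proof).  With `K` in hand, Mathlib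
`NumberField.CMExtension.equivMaximalRealSubfield F K : F ≃+* ↥(maximalRealSubfield K)` is the place-transporting identification `F = K⁺`. [folklore] -/
theorem exists_isCMField_of_forall_re_neg (F : Type) [Field F] [NumberField F] [IsTotallyReal F] (γ : F) (hγ : ∀ σ : F →+* ℂ, (σ γ).re < 0) :
    ∃ (K : Type) (_ : Field K) (_ : NumberField K) (_ : Algebra F K),
      IsQuadraticExtension F K ∧ IsCMField K ∧ (∃ θ : K, θ ^ 2 = algebraMap F K γ) ∧
        Module.finrank ℚ ↥(maximalRealSubfield K) = Module.finrank ℚ F := by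
  haveI : Fact (Irreducible (X ^ 2 - C γ : F[X])) := ⟨irreducible_X_sq_sub_C_of_forall_re_neg hγ⟩
  have hf0 : (X ^ 2 - C γ : F[X]) ≠ 0 := (irreducible_X_sq_sub_C_of_forall_re_neg hγ).ne_zero
  -- the power basis `1, θ` of `K := AdjoinRoot (X² − C γ)` gives `[K : F] = natDegree = 2`
  have hdim : Module.finrank F (AdjoinRoot (X ^ 2 - C γ : F[X])) = 2 := by
    rw [(AdjoinRoot.powerBasis hf0).finrank, AdjoinRoot.powerBasis_dim, natDegree_X_sq_sub_C]
  haveI hq : IsQuadraticExtension F (AdjoinRoot (X ^ 2 - C γ : F[X])) := { finrank_eq_two' := hdim }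
  haveI : Module.Finite F (AdjoinRoot (X ^ 2 - C γ : F[X])) := (AdjoinRoot.powerBasis hf0).finite
  haveI hK : NumberField (AdjoinRoot (X ^ 2 - C γ : F[X])) := NumberField.of_module_finite F _
  have hθ : (AdjoinRoot.root (X ^ 2 - C γ : F[X])) ^ 2 = algebraMap F (AdjoinRoot (X ^ 2 - C γ : F[X])) γ := by
    have h := AdjoinRoot.eval₂_root (X ^ 2 - C γ : F[X])
    rw [eval₂_sub, eval₂_X_pow, eval₂_C, sub_eq_zero] at h
    rw [h, AdjoinRoot.algebraMap_eq]
  haveI hcm : IsCMField (AdjoinRoot (X ^ 2 - C γ : F[X])) := isCMField_of_sq_eq_of_forall_re_neg F _ hγ hθ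
  exact ⟨AdjoinRoot (X ^ 2 - C γ : F[X]), inferInstance, hK, inferInstance, hq, hcm, ⟨_, hθ⟩,
    finrank_maximalRealSubfield_eq_of_isQuadraticExtension F _⟩

/-! ## §5 Transport along `F ≃+* K⁺` (the re-indexing kit P8 consumes; stated for any ring isomorphism of number fields)

For the CM field `K` of §4, Mathlib `NumberField.CMExtension.equivMaximalRealSubfield F K : F ≃+* ↥(maximalRealSubfield K)` identifies the planted
field `F` with `K⁺`, compatibly with the two maps to `K` (Mathlib `CMExtension.equivMaximalRealSubfield_apply`).  The lemmas below move the planted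
generator's invariants (norm, minimal polynomial, integrality, signs at the embeddings) along ANY ring isomorphism `e : F ≃+* F₂` of fields of
characteristic zero, so that the bricks stated over an arbitrary number field (P5 ★ `R90S3UnitAwayFromPlantedPlace`, P6) are applied to `K⁺` directly. -/

section Transport

variable {F F₂ : Type*} [Field F] [CharZero F] [Field F₂] [CharZero F₂] (e : F ≃+* F₂)

/-- A ring isomorphism of characteristic-zero fields is a `ℚ`-algebra isomorphism (Mathlib `AlgEquiv.ofRingEquiv`, `map_ratCast`); recorded as the
equation `(AlgEquiv.ofRingEquiv _ : F ≃ₐ[ℚ] F₂) x = e x` so that the `ℚ`-linear invariants below transport. [folklore] -/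
theorem algEquiv_ofRingEquiv_rat_apply (x : F) :
    (AlgEquiv.ofRingEquiv (f := e) (fun q => by simp) : F ≃ₐ[ℚ] F₂) x = e x := rfl

/-- **Norm transport**: `N_{F₂∕ℚ}(e x) = N_{F∕ℚ}(x)` (Mathlib `Algebra.norm_eq_of_algEquiv`). [folklore] -/
theorem norm_rat_ringEquiv_apply (x : F) : Algebra.norm ℚ (e x) = Algebra.norm ℚ x := by
  rw [← algEquiv_ofRingEquiv_rat_apply e x]
  exact Algebra.norm_eq_of_algEquiv _ x

/-- **Minimal-polynomial transport**: `minpoly ℚ (e x) = minpoly ℚ x` (Mathlib `minpoly.algEquiv_eq`). [folklore] -/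
theorem minpoly_rat_ringEquiv_apply (x : F) : minpoly ℚ (e x) = minpoly ℚ x := by
  rw [← algEquiv_ofRingEquiv_rat_apply e x]
  exact minpoly.algEquiv_eq _ x

omit [CharZero F] [CharZero F₂] in
/-- **Integrality transport**: `e x` is an algebraic integer iff `x` is (Mathlib `map_isIntegral_int` both ways); the ring-of-integers isomorphism itself
is Mathlib `NumberField.RingOfIntegers.mapRingEquiv e : 𝓞 F ≃+* 𝓞 F₂` (`mapRingEquiv_apply`). [folklore] -/
theorem isIntegral_int_ringEquiv_apply_iff (x : F) : IsIntegral ℤ (e x) ↔ IsIntegral ℤ x :=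
  ⟨fun h => by simpa using map_isIntegral_int e.symm h, fun h => map_isIntegral_int e h⟩

omit [CharZero F] [CharZero F₂] in
/-- **Sign transport at the embeddings**: the conjugates of `e x` are the conjugates of `x` (`σ₂ ↦ σ₂ ∘ e` is a bijection of complex embeddings), so
«totally negative» is invariant: `(∀ σ₂ : F₂ →+* ℂ, re (σ₂ (e x)) < 0) ↔ (∀ σ : F →+* ℂ, re (σ x) < 0)`. [folklore] -/
theorem forall_re_neg_ringEquiv_apply_iff (x : F) :
    (∀ σ₂ : F₂ →+* ℂ, (σ₂ (e x)).re < 0) ↔ ∀ σ : F →+* ℂ, (σ x).re < 0 := by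
  constructor
  · intro h σ
    have h' := h (σ.comp e.symm.toRingHom)
    simpa using h'
  · intro h σ₂
    exact h (σ₂.comp e.toRingHom)

end Transport

/-- **`F = K⁺` compatibly with `K`** (Mathlib, recorded by name for P8): for a CM extension `K ∕ F` the isomorphism
`e := NumberField.CMExtension.equivMaximalRealSubfield F K` satisfies `algebraMap K⁺ K (e x) = algebraMap F K x`; in particular a square root `θ` of
`algebraMap F K γ` is a square root of `algebraMap K⁺ K (e γ)`. [folklore] -/
theorem sq_eq_algebraMap_equivMaximalRealSubfield (F : Type*) [Field F] (K : Type*) [Field K] [NumberField K] [Algebra F K] [IsTotallyReal F]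
    [IsTotallyComplex K] [IsQuadraticExtension F K] {γ : F} {θ : K} (hθ : θ ^ 2 = algebraMap F K γ) :
    θ ^ 2 = algebraMap ↥(maximalRealSubfield K) K (CMExtension.equivMaximalRealSubfield F K γ) := by
  rw [hθ]
  exact (CMExtension.equivMaximalRealSubfield_apply F K γ).symm

end Summit.HodgeConjecture.HodgeConjecture.R90.S3

end
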